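import Mathlib.Analysis.CStarAlgebra.Matrix
import Mathlib.LinearAlgebra.Matrix.Charpoly.Eigs
import Mathlib.LinearAlgebra.Matrix.Block
import Mathlib.Analysis.Normed.Algebra.Spectrum
import Mathlib.Analysis.SpecificLimits.Normed
import Mathlib.FieldTheory.IsAlgClosed.Basic
import Mathlib.Analysis.Complex.Polynomial.Basic
import HarnessLib

/-!
# Determinants of small-block perturbations of the identity (matrix toolkit)

Generic finite-dimensional linear algebra over `ℂ` in the `ℓ²` operator norm, for the
quasi-locality of the Wilson fermion determinant (route `SeaNonGibbs`, item
`UniformLoopPotential`):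

* `norm_le_of_mem_spectrum` — spectral values are bounded by the operator norm;
* `spectrum_toSquareBlockProp_subset` — for `M` supported on the block `S × S`, the spectrum of the
  compression `M|_S` is contained in that of `M`;
* `det_one_add_eq_det_block` — `det(1 + M) = det(1_S + M|_S)` for such `M`;
* `pow_card_le_norm_det_one_add`, `norm_det_one_add_le_pow_card` — hence
  `(1 − δ)^{#S} ≤ |det(1 + M)| ≤ (1 + δ)^{#S}` whenever `‖M‖ ≤ δ ≤ 1`: the exponent is the size of
  the block, not of the ambient index set;
* `norm_inv_one_sub_le` — the Neumann bound `‖(1 − A)⁻¹‖ ≤ 1/(1 − θ)` for `‖A‖ ≤ θ < 1`.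

Pure Mathlib; nothing about lattice QCD is asserted here (seat ym-line-fcl-p3 g19, free hands).
-/

noncomputable section

open scoped Matrix.Norms.L2Operator
open Matrix Polynomial

namespace Summit.QuantumFields.QCD.Theorems

namespace UniformLoopPotential

variable {ι : Type*} [Fintype ι] [DecidableEq ι]

/-- `‖1‖ ≤ 1` in the `ℓ²` operator norm. -/
theorem l2_opNorm_one_le : ‖(1 : Matrix ι ι ℂ)‖ ≤ 1 := by
  rw [Matrix.cstar_norm_def, map_one]
  exact ContinuousLinearMap.norm_id_le

/-- Every point of the spectrum of a complex matrix is bounded by its operator norm. -/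
theorem norm_le_of_mem_spectrum {B : Matrix ι ι ℂ} {z : ℂ} (hz : z ∈ spectrum ℂ B) :
    ‖z‖ ≤ ‖B‖ := by
  haveI : CompleteSpace (Matrix ι ι ℂ) := FiniteDimensional.complete ℂ _
  exact (spectrum.norm_le_norm_mul_of_mem hz).trans
    (mul_le_of_le_one_right (norm_nonneg _) l2_opNorm_one_le)

/-- `1 − A` is invertible for `‖A‖ < 1`. -/
theorem isUnit_one_sub_of_norm_lt {A : Matrix ι ι ℂ} (hA : ‖A‖ < 1) :
    IsUnit ((1 : Matrix ι ι ℂ) - A) := by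
  haveI : CompleteSpace (Matrix ι ι ℂ) := FiniteDimensional.complete ℂ _
  exact isUnit_one_sub_of_norm_lt_one hA

/-- **Neumann bound**: `‖(1 − A)⁻¹‖ ≤ 1/(1 − θ)` for `‖A‖ ≤ θ < 1`. -/
theorem norm_inv_one_sub_le {A : Matrix ι ι ℂ} {θ : ℝ} (hA : ‖A‖ ≤ θ) (hθ : θ < 1) :
    ‖((1 : Matrix ι ι ℂ) - A)⁻¹‖ ≤ 1 / (1 - θ) := by
  haveI : CompleteSpace (Matrix ι ι ℂ) := FiniteDimensional.complete ℂ _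
  have h : ‖A‖ < 1 := hA.trans_lt hθ
  rw [Matrix.nonsing_inv_eq_ringInverse, ← geom_series_eq_inverse A h]
  calc ‖∑' i : ℕ, A ^ i‖ ≤ ‖(1 : Matrix ι ι ℂ)‖ - 1 + (1 - ‖A‖)⁻¹ :=
        tsum_geometric_le_of_norm_lt_one A h
    _ ≤ (1 - ‖A‖)⁻¹ := by linarith [l2_opNorm_one_le (ι := ι)]
    _ ≤ 1 / (1 - θ) := by
        rw [one_div]
        exact inv_anti₀ (by linarith) (by linarith)

/-- `‖Aⁿ X‖ ≤ θⁿ ‖X‖` for `‖A‖ ≤ θ`. -/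
theorem norm_pow_mul_le {A : Matrix ι ι ℂ} {θ : ℝ} (hA : ‖A‖ ≤ θ) (X : Matrix ι ι ℂ) (n : ℕ) :
    ‖A ^ n * X‖ ≤ θ ^ n * ‖X‖ := by
  have hθ0 : 0 ≤ θ := (norm_nonneg A).trans hA
  induction n with
  | zero => simp
  | succ n ih =>
      calc ‖A ^ (n + 1) * X‖ = ‖A * (A ^ n * X)‖ := by rw [pow_succ', Matrix.mul_assoc]
        _ ≤ ‖A‖ * ‖A ^ n * X‖ := Matrix.l2_opNorm_mul _ _
        _ ≤ θ * (θ ^ n * ‖X‖) := mul_le_mul hA ih (norm_nonneg _) hθ0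
        _ = θ ^ (n + 1) * ‖X‖ := by rw [pow_succ]; ring

/-- `‖X Aⁿ‖ ≤ ‖X‖ θⁿ` for `‖A‖ ≤ θ`. -/
theorem norm_mul_pow_le {A : Matrix ι ι ℂ} {θ : ℝ} (hA : ‖A‖ ≤ θ) (X : Matrix ι ι ℂ) (n : ℕ) :
    ‖X * A ^ n‖ ≤ ‖X‖ * θ ^ n := by
  have hθ0 : 0 ≤ θ := (norm_nonneg A).trans hA
  induction n with
  | zero => simp
  | succ n ih =>
      calc ‖X * A ^ (n + 1)‖ = ‖X * A ^ n * A‖ := by rw [pow_succ, Matrix.mul_assoc]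
        _ ≤ ‖X * A ^ n‖ * ‖A‖ := Matrix.l2_opNorm_mul _ _
        _ ≤ ‖X‖ * θ ^ n * θ := mul_le_mul ih hA (norm_nonneg _)
            (mul_nonneg (norm_nonneg _) (pow_nonneg hθ0 _))
        _ = ‖X‖ * θ ^ (n + 1) := by rw [pow_succ]; ring

section Block

variable (p : ι → Prop) [DecidablePred p]

/-- **`det(1 + M) = det(1_S + M|_S)` for `M` supported on `S × S`** (`S = {i | p i}`): the matrix
`1 + M` is block-triangular with the identity on the complementary block. -/
theorem det_one_add_eq_det_block (M : Matrix ι ι ℂ) (hM : ∀ i j, ¬ (p i ∧ p j) → M i j = 0) :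
    (1 + M).det = (1 + M.toSquareBlockProp p).det := by
  rw [Matrix.twoBlockTriangular_det (1 + M) p (fun i hi j hj => by
    rw [Matrix.add_apply, hM i j (fun h => hi h.1), add_zero, Matrix.one_apply_ne]
    rintro rfl; exact hi hj)]
  have h2 : (1 + M).toSquareBlockProp (fun i => ¬ p i) = 1 := by
    ext ⟨i, hi⟩ ⟨j, hj⟩
    simp only [Matrix.toSquareBlockProp_def, Matrix.of_apply, Matrix.add_apply,
      hM i j (fun h => hi h.1), add_zero, Matrix.one_apply, Subtype.mk.injEq]
  have h1 : (1 + M).toSquareBlockProp p = 1 + M.toSquareBlockProp p := by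
    ext ⟨i, hi⟩ ⟨j, hj⟩
    simp only [Matrix.toSquareBlockProp_def, Matrix.of_apply, Matrix.add_apply, Matrix.one_apply,
      Subtype.mk.injEq]
  rw [h2, Matrix.det_one, mul_one, h1]

omit [DecidableEq ι] in
/-- A sum over `ι` of terms supported on `S` is a sum over `S`. -/
theorem sum_mul_extend_eq (g : {j // p j} → ℂ) (c : ι → ℂ) :
    ∑ j, c j * (if h : p j then g ⟨j, h⟩ else 0) = ∑ s : {j // p j}, c s.1 * g s := by
  rw [← Finset.sum_filter_of_ne (p := p) (s := Finset.univ) (fun j _ hj => by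
      by_contra h
      rw [dif_neg h, mul_zero] at hj
      exact hj rfl),
    Finset.sum_subtype (p := p) (Finset.univ.filter p) (fun x => by simp)]
  exact Finset.sum_congr rfl fun s _ => by rw [dif_pos s.2]

/-- **The spectrum of the compression `M|_S` lies in the spectrum of `M`** when `M` is supported
on `S × S` (extend an eigenvector by zero). -/
theorem spectrum_toSquareBlockProp_subset (M : Matrix ι ι ℂ)
    (hM : ∀ i j, ¬ (p i ∧ p j) → M i j = 0) :
    spectrum ℂ (M.toSquareBlockProp p) ⊆ spectrum ℂ M := by
  intro z hz
  rw [spectrum.mem_iff, Algebra.algebraMap_eq_smul_one, Matrix.isUnit_iff_isUnit_det,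
    isUnit_iff_ne_zero, ne_eq, not_not] at hz ⊢
  obtain ⟨v, hv0, hv⟩ := Matrix.exists_mulVec_eq_zero_iff.2 hz
  -- extend `v` by zero
  let w : ι → ℂ := fun i => if h : p i then v ⟨i, h⟩ else 0
  have hw0 : w ≠ 0 := by
    intro hw
    apply hv0
    funext ⟨i, hi⟩
    have := congrFun hw i
    simp only [w, dif_pos hi, Pi.zero_apply] at this
    exact this
  have hmul : ∀ i, ((z • (1 : Matrix ι ι ℂ) - M) *ᵥ w) i =
      ∑ s : {j // p j}, ((if i = s.1 then z else 0) - M i s.1) * v s := fun i => by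
    simp only [Matrix.mulVec, dotProduct, Matrix.sub_apply, Matrix.smul_apply, Matrix.one_apply,
      smul_eq_mul, mul_ite, mul_one, mul_zero, w]
    exact sum_mul_extend_eq p v _
  refine Matrix.exists_mulVec_eq_zero_iff.1 ⟨w, hw0, ?_⟩
  funext i
  rw [hmul, Pi.zero_apply]
  by_cases hi : p i
  · -- a row of the block: the corresponding row of `(z - M|_S) v = 0`
    have hvi := congrFun hv ⟨i, hi⟩
    simp only [Matrix.mulVec, dotProduct, Matrix.sub_apply, Matrix.smul_apply, Matrix.one_apply,
      Matrix.toSquareBlockProp_def, Matrix.of_apply, smul_eq_mul, mul_ite, mul_one, mul_zero,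
      Pi.zero_apply] at hvi
    refine Eq.trans (Finset.sum_congr rfl fun s _ => ?_) hvi
    rcases s with ⟨j, hj⟩
    simp only [Subtype.mk.injEq]
  · exact Finset.sum_eq_zero fun s _ => by
      rcases s with ⟨j, hj⟩
      have hij : i ≠ j := fun h => hi (h ▸ hj)
      simp only [hij, if_false, hM i j (fun h => hi h.1), sub_zero, zero_mul]

end Block

/-- Lower product bound over a multiset. -/
theorem pow_card_le_norm_multiset_prod {s : Multiset ℂ} {c : ℝ} (hc : 0 ≤ c)
    (h : ∀ z ∈ s, c ≤ ‖z‖) : c ^ Multiset.card s ≤ ‖s.prod‖ := by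
  induction s using Multiset.induction_on with
  | empty => simp
  | cons a s ih =>
    rw [Multiset.prod_cons, Multiset.card_cons, norm_mul, pow_succ']
    exact mul_le_mul (h a (Multiset.mem_cons_self a s))
      (ih fun z hz => h z (Multiset.mem_cons_of_mem hz)) (pow_nonneg hc _) (norm_nonneg _)

/-- Upper product bound over a multiset. -/
theorem norm_multiset_prod_le_pow_card {s : Multiset ℂ} {c : ℝ} (hc : 0 ≤ c)
    (h : ∀ z ∈ s, ‖z‖ ≤ c) : ‖s.prod‖ ≤ c ^ Multiset.card s := by
  induction s using Multiset.induction_on with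
  | empty => simp
  | cons a s ih =>
    rw [Multiset.prod_cons, Multiset.card_cons, norm_mul, pow_succ']
    exact mul_le_mul (h a (Multiset.mem_cons_self a s))
      (ih fun z hz => h z (Multiset.mem_cons_of_mem hz)) (norm_nonneg _) hc

/-- **`det(1 + Y)` through the eigenvalues of `Y`**: `|det(1 + Y)| = |∏ (1 + λᵢ)|` over the
`#κ` roots of the characteristic polynomial. -/
theorem norm_det_one_add_eq_prod_roots {κ : Type*} [Fintype κ] [DecidableEq κ] (Y : Matrix κ κ ℂ) :
    ‖(1 + Y).det‖ = ‖(Y.charpoly.roots.map fun a => (-1 : ℂ) - a).prod‖ := by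
  have hs : Y.charpoly.Splits := IsAlgClosed.splits Y.charpoly
  rw [← hs.eval_eq_prod_roots_of_monic Y.charpoly_monic (-1), Matrix.eval_charpoly, map_neg, map_one, show (-1 : Matrix κ κ ℂ) - Y = -(1 + Y) by abel,
    Matrix.det_neg, norm_mul, norm_pow, norm_neg, norm_one, one_pow, one_mul]

/-- **Spectral two-sided bound**: if every spectral value of `Y` has modulus `≤ δ ≤ 1`, then
`(1 − δ)^{#κ} ≤ |det(1 + Y)| ≤ (1 + δ)^{#κ}`. -/
theorem det_one_add_bounds_of_spectrum {κ : Type*} [Fintype κ] [DecidableEq κ] (Y : Matrix κ κ ℂ)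
    {δ : ℝ} (hδ0 : 0 ≤ δ) (hδ1 : δ ≤ 1) (hY : ∀ z ∈ spectrum ℂ Y, ‖z‖ ≤ δ) :
    (1 - δ) ^ Fintype.card κ ≤ ‖(1 + Y).det‖ ∧ ‖(1 + Y).det‖ ≤ (1 + δ) ^ Fintype.card κ := by
  have hcard : Multiset.card Y.charpoly.roots = Fintype.card κ := by
    rw [← Matrix.charpoly_natDegree_eq_dim Y]
    exact Polynomial.splits_iff_card_roots.1 (IsAlgClosed.splits Y.charpoly)
  have hroot : ∀ a ∈ Y.charpoly.roots, ‖a‖ ≤ δ := fun a ha =>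
    hY a (Matrix.mem_spectrum_of_isRoot_charpoly
      ((Polynomial.mem_roots Y.charpoly_monic.ne_zero).1 ha))
  rw [norm_det_one_add_eq_prod_roots, ← hcard, ← Multiset.card_map (fun a => (-1 : ℂ) - a)]
  constructor
  · refine pow_card_le_norm_multiset_prod (by linarith) fun z hz => ?_
    obtain ⟨a, ha, rfl⟩ := Multiset.mem_map.1 hz
    calc 1 - δ ≤ 1 - ‖a‖ := by linarith [hroot a ha]
      _ = ‖(-1 : ℂ)‖ - ‖a‖ := by rw [norm_neg, norm_one]
      _ ≤ ‖(-1 : ℂ) - a‖ := norm_sub_norm_le _ _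
  · refine norm_multiset_prod_le_pow_card (by linarith) fun z hz => ?_
    obtain ⟨a, ha, rfl⟩ := Multiset.mem_map.1 hz
    calc ‖(-1 : ℂ) - a‖ ≤ ‖(-1 : ℂ)‖ + ‖a‖ := norm_sub_le _ _
      _ ≤ 1 + δ := by rw [norm_neg, norm_one]; linarith [hroot a ha]

/-- **Two-sided bound with the BLOCK exponent**: for `M` supported on `S × S` with `‖M‖ ≤ δ ≤ 1`
and `#S ≤ K`, `(1 − δ)^K ≤ |det(1 + M)| ≤ (1 + δ)^K`. -/
theorem det_one_add_block_bounds (p : ι → Prop) [DecidablePred p] (M : Matrix ι ι ℂ)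
    (hM : ∀ i j, ¬ (p i ∧ p j) → M i j = 0) {δ : ℝ} (hδ0 : 0 ≤ δ) (hδ1 : δ ≤ 1) (hMδ : ‖M‖ ≤ δ)
    {K : ℕ} (hK : Fintype.card {i // p i} ≤ K) :
    (1 - δ) ^ K ≤ ‖(1 + M).det‖ ∧ ‖(1 + M).det‖ ≤ (1 + δ) ^ K := by
  rw [det_one_add_eq_det_block p M hM]
  obtain ⟨h1, h2⟩ := det_one_add_bounds_of_spectrum (M.toSquareBlockProp p) hδ0 hδ1 fun z hz =>
    (norm_le_of_mem_spectrum (spectrum_toSquareBlockProp_subset p M hM hz)).trans hMδ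
  exact ⟨(pow_le_pow_of_le_one (by linarith) (by linarith) hK).trans h1,
    h2.trans (pow_le_pow_right₀ (by linarith) hK)⟩

section NearBlock

variable (p : ι → Prop) [DecidablePred p]

/-- Entries of `P X`. -/
theorem proj_mul_apply (X : Matrix ι ι ℂ) (i j : ι) :
    ((Matrix.diagonal fun k => if p k then (1 : ℂ) else 0) * X) i j = if p i then X i j else 0 := by
  rw [Matrix.diagonal_mul]; split_ifs <;> simp

/-- Entries of `X P`. -/
theorem mul_proj_apply (X : Matrix ι ι ℂ) (i j : ι) :
    (X * Matrix.diagonal fun k => if p k then (1 : ℂ) else 0) i j = if p j then X i j else 0 := by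
  rw [Matrix.mul_diagonal]; split_ifs <;> simp

/-- `P² = P`. -/
theorem proj_mul_proj :
    (Matrix.diagonal fun k => if p k then (1 : ℂ) else 0) * (Matrix.diagonal fun k => if p k then (1 : ℂ) else 0) =
      Matrix.diagonal fun k => if p k then (1 : ℂ) else 0 := by
  rw [Matrix.diagonal_mul_diagonal]
  congr 1; funext k; split_ifs <;> simp

/-- `P X P` is supported on `S × S`. -/
theorem proj_mul_mul_proj_supported (X : Matrix ι ι ℂ) (i j : ι) (hij : ¬ (p i ∧ p j)) :
    ((Matrix.diagonal fun k => if p k then (1 : ℂ) else 0) * X *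
      Matrix.diagonal fun k => if p k then (1 : ℂ) else 0) i j = 0 := by
  rw [mul_proj_apply, proj_mul_apply]
  by_cases hi : p i
  · rw [if_neg (fun hj => hij ⟨hi, hj⟩)]
  · simp [hi]

/-- A matrix supported on `S × S` is fixed by `P` on the left. -/
theorem proj_mul_of_supported {E : Matrix ι ι ℂ} (hE : ∀ i j, ¬ (p i ∧ p j) → E i j = 0) :
    (Matrix.diagonal fun k => if p k then (1 : ℂ) else 0) * E = E := by
  ext i j
  rw [proj_mul_apply]
  split_ifs with hi
  · rfl
  · exact (hE i j fun h => hi h.1).symm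

/-- A matrix supported on `S × S` is fixed by `P` on the right. -/
theorem mul_proj_of_supported {E : Matrix ι ι ℂ} (hE : ∀ i j, ¬ (p i ∧ p j) → E i j = 0) :
    E * (Matrix.diagonal fun k => if p k then (1 : ℂ) else 0) = E := by
  ext i j
  rw [mul_proj_apply]
  split_ifs with hj
  · rfl
  · exact (hE i j fun h => hj h.2).symm

/-- `‖P‖ ≤ 1`. -/
theorem norm_proj_le_one : ‖(Matrix.diagonal fun k => if p k then (1 : ℂ) else 0)‖ ≤ 1 := by
  rw [Matrix.l2_opNorm_diagonal]
  refine (pi_norm_le_iff_of_nonneg zero_le_one).2 fun k => ?_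
  split_ifs <;> simp

/-- `‖1 − P‖ ≤ 1`. -/
theorem norm_one_sub_proj_le_one :
    ‖(1 : Matrix ι ι ℂ) - Matrix.diagonal fun k => if p k then (1 : ℂ) else 0‖ ≤ 1 := by
  have : (1 : Matrix ι ι ℂ) - (Matrix.diagonal fun k => if p k then (1 : ℂ) else 0) =
      Matrix.diagonal fun k => if p k then (0 : ℂ) else 1 := by
    ext i j
    rw [Matrix.sub_apply, Matrix.one_apply, Matrix.diagonal_apply, Matrix.diagonal_apply]
    split_ifs <;> simp
  rw [this, Matrix.l2_opNorm_diagonal]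
  refine (pi_norm_le_iff_of_nonneg zero_le_one).2 fun k => ?_
  split_ifs <;> simp

/-- **Compression of the resolvent**: for `E` supported on `S × S`,
`det(1 + E R) = det(1 + E (P R P))` (Weinstein–Aronszajn). -/
theorem det_one_add_mul_eq_compressed {E : Matrix ι ι ℂ} (hE : ∀ i j, ¬ (p i ∧ p j) → E i j = 0)
    (R : Matrix ι ι ℂ) :
    (1 + E * R).det = (1 + E * ((Matrix.diagonal fun k => if p k then (1 : ℂ) else 0) * R *
      Matrix.diagonal fun k => if p k then (1 : ℂ) else 0)).det := by
  set P : Matrix ι ι ℂ := Matrix.diagonal fun k => if p k then (1 : ℂ) else 0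
  have hPE : P * E = E := proj_mul_of_supported p hE
  have hEP : E * P = E := mul_proj_of_supported p hE
  calc (1 + E * R).det = (1 + P * (E * R)).det := by rw [← Matrix.mul_assoc, hPE]
    _ = (1 + E * R * P).det := by rw [← Matrix.det_one_add_mul_comm]
    _ = (1 + E * (P * R * P)).det := by
        rw [show E * (P * R * P) = E * R * P by rw [← Matrix.mul_assoc, ← Matrix.mul_assoc, hEP]]

/-- **Inverse of the compressed perturbation**: with `T = 1 + E R` invertible and `E = P E P`,
`(1 + E (P R P)) · (1 − P + T⁻¹ P) = 1`. -/
theorem one_add_compressed_mul_eq_one {E : Matrix ι ι ℂ} (hE : ∀ i j, ¬ (p i ∧ p j) → E i j = 0)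
    (R : Matrix ι ι ℂ) (hT : IsUnit (1 + E * R).det) :
    (1 + E * ((Matrix.diagonal fun k => if p k then (1 : ℂ) else 0) * R *
        Matrix.diagonal fun k => if p k then (1 : ℂ) else 0)) *
      (1 - (Matrix.diagonal fun k => if p k then (1 : ℂ) else 0) +
        (1 + E * R)⁻¹ * Matrix.diagonal fun k => if p k then (1 : ℂ) else 0) = 1 := by
  set P : Matrix ι ι ℂ := Matrix.diagonal fun k => if p k then (1 : ℂ) else 0 with hPdef
  set T : Matrix ι ι ℂ := 1 + E * R with hTdef
  have hPP : P * P = P := proj_mul_proj p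
  have hPE : P * E = E := proj_mul_of_supported p hE
  have hEP : E * P = E := mul_proj_of_supported p hE
  have hTT : T * T⁻¹ = 1 := Matrix.mul_nonsing_inv T hT
  -- `(1 - P) T = 1 - P`, hence `(1 - P) T⁻¹ = 1 - P`
  have h1 : (1 - P) * T = 1 - P := by
    rw [hTdef, Matrix.mul_add, Matrix.mul_one, ← Matrix.mul_assoc, Matrix.sub_mul, Matrix.one_mul, hPE,
      sub_self, Matrix.zero_mul, add_zero]
  have h2 : (1 - P) * T⁻¹ = 1 - P := by
    calc (1 - P) * T⁻¹ = (1 - P) * T * T⁻¹ := by rw [h1]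
      _ = 1 - P := by rw [Matrix.mul_assoc, hTT, Matrix.mul_one]
  -- hence `P T⁻¹ P = T⁻¹ P`
  have h3 : P * T⁻¹ * P = T⁻¹ * P := by
    have hsplit : P * T⁻¹ = T⁻¹ - (1 - P) := by
      have : (P + (1 - P)) * T⁻¹ = T⁻¹ := by rw [add_sub_cancel, Matrix.one_mul]
      rw [Matrix.add_mul, h2] at this
      exact eq_sub_of_add_eq this
    rw [hsplit, Matrix.sub_mul, Matrix.sub_mul, Matrix.one_mul, hPP, sub_self, sub_zero]
  -- expand
  have h4 : E * (P * R * P) = E * R * P := by rw [← Matrix.mul_assoc, ← Matrix.mul_assoc, hEP]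
  have hA : (1 + E * R * P) * (1 - P) = 1 - P := by
    rw [Matrix.add_mul, Matrix.one_mul, Matrix.mul_sub, Matrix.mul_one, Matrix.mul_assoc (E * R) P P,
      hPP, sub_self, add_zero]
  have hB : (1 + E * R * P) * (T⁻¹ * P) = P := by
    calc (1 + E * R * P) * (T⁻¹ * P) = T⁻¹ * P + E * R * (P * T⁻¹ * P) := by
          rw [Matrix.add_mul, Matrix.one_mul, Matrix.mul_assoc (E * R) P, ← Matrix.mul_assoc P T⁻¹ P]
      _ = (1 + E * R) * (T⁻¹ * P) := by rw [h3, Matrix.add_mul, Matrix.one_mul]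
      _ = P := by rw [← hTdef, ← Matrix.mul_assoc, hTT, Matrix.one_mul]
  rw [h4, Matrix.mul_add, hA, hB, sub_add_cancel]

/-- **Norm of that inverse**: `‖(1 + E (P R P))⁻¹‖ ≤ 1 + ‖(1 + E R)⁻¹‖`. -/
theorem norm_inv_one_add_compressed_le {E : Matrix ι ι ℂ} (hE : ∀ i j, ¬ (p i ∧ p j) → E i j = 0)
    (R : Matrix ι ι ℂ) (hT : IsUnit (1 + E * R).det) :
    ‖(1 + E * ((Matrix.diagonal fun k => if p k then (1 : ℂ) else 0) * R *
        Matrix.diagonal fun k => if p k then (1 : ℂ) else 0))⁻¹‖ ≤ 1 + ‖(1 + E * R)⁻¹‖ := by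
  rw [Matrix.inv_eq_right_inv (one_add_compressed_mul_eq_one p hE R hT)]
  calc _ ≤ ‖(1 : Matrix ι ι ℂ) - Matrix.diagonal fun k => if p k then (1 : ℂ) else 0‖ +
        ‖(1 + E * R)⁻¹ * Matrix.diagonal fun k => if p k then (1 : ℂ) else 0‖ := norm_add_le _ _
    _ ≤ 1 + ‖(1 + E * R)⁻¹‖ * 1 := add_le_add (norm_one_sub_proj_le_one p)
        ((Matrix.l2_opNorm_mul _ _).trans (mul_le_mul_of_nonneg_left (norm_proj_le_one p) (norm_nonneg _)))
    _ = 1 + ‖(1 + E * R)⁻¹‖ := by rw [mul_one]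

/-- **The perturbation step.** With `K = P R P`, `K' = P R' P`, `V' = 1 + E K'` invertible:
`det(1 + E K) = det V' · det(1 + P X P)` where `X = V'⁻¹ E (K − K')`. -/
theorem det_one_add_compressed_eq_mul (E R R' : Matrix ι ι ℂ)
    (hV : IsUnit (1 + E * ((Matrix.diagonal fun k => if p k then (1 : ℂ) else 0) * R' *
      Matrix.diagonal fun k => if p k then (1 : ℂ) else 0)).det) :
    let P : Matrix ι ι ℂ := Matrix.diagonal fun k => if p k then (1 : ℂ) else 0
    (1 + E * (P * R * P)).det = (1 + E * (P * R' * P)).det *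
      (1 + P * ((1 + E * (P * R' * P))⁻¹ * E * (P * R * P - P * R' * P)) * P).det := by
  intro P
  set V' : Matrix ι ι ℂ := 1 + E * (P * R' * P) with hV'def
  set X : Matrix ι ι ℂ := V'⁻¹ * E * (P * R * P - P * R' * P) with hXdef
  have hPP : P * P = P := proj_mul_proj p
  have hXP : X * P = X := by
    rw [hXdef, Matrix.mul_assoc, Matrix.sub_mul, Matrix.mul_assoc (P * R) P P, hPP,
      Matrix.mul_assoc (P * R') P P, hPP]
  have hfac : 1 + E * (P * R * P) = V' * (1 + X) := by
    have : V' * X = E * (P * R * P - P * R' * P) := by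
      rw [hXdef, ← Matrix.mul_assoc, ← Matrix.mul_assoc, Matrix.mul_nonsing_inv V' hV, Matrix.one_mul]
    rw [Matrix.mul_add, Matrix.mul_one, this, Matrix.mul_sub, hV'def]
    abel
  rw [hfac, Matrix.det_mul]
  congr 1
  calc (1 + X).det = (1 + X * P).det := by rw [hXP]
    _ = (1 + P * X).det := Matrix.det_one_add_mul_comm _ _
    _ = (1 + P * X * P).det := by rw [Matrix.mul_assoc, hXP]

end NearBlock

end UniformLoopPotential

end Summit.QuantumFields.QCD.Theorems

end
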